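import Literature.NumberTheory.Transcendental.EclClosedSubfield
import Literature.NumberTheory.Transcendental.VarietyAscentRotund
import Literature.NumberTheory.Transcendental.ZilberFieldHomogeneityProofs
import HarnessLib

/-!
# `ecl`-closed E-subfields of Zilber fields are Zilber fields (the "SGClosed lemma")

M. Bays, J. Kirby, *Pseudo-exponential maps, variants, and quasiminimality*, Algebra & Number
Theory 12 (2018) 493–549, proof of Thm 8.2 ("For axiom 4, suppose `A ◁ F` is finitely generated
and `A ◁ B` is a finitely generated and Γ-algebraic extension. Since `M` is `C_fg`-saturated, `B`
embeds strongly into `M` over `A` and since `F` is closed in `M`, `B ⊆ F`. So by Lemma 8.3, `F`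
satisfies axiom 4") with Lemma 8.3 (axiom 4 versus `ℵ₀`-saturation for Γ-algebraic extensions:
"by axiom 4 … there is `c ∈ Γ(F)ⁿ ∩ V(F)`, linearly independent over `Γ(F_base) ∪ {a}`. Since
`A ◁ F` we have `δ(c/A) ≥ 0`, so `td(c/A) = dn = dim V`"); B. Zilber, Ann. Pure Appl. Logic 132
(2005), §5; M. Bays, J. Kirby, arXiv:1305.0493 (2013), Prop. 4 (Kirby's axiom I.2 for
`ECF_{SK,CCP}`: `ecl`-closed subsets of models are models).

For a Zilber field `K` and `X ⊆ K` we prove that the `ecl`-closed E-subfield `E = ecl X`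
(`Khovanskii.eclSubfield X`) is strongly exponentially-algebraically closed in Kirby's
linear-independence form (`IsLinIndepExpAlgClosed`), and hence (`EclClosedSubfield.lean`,
`IsZilberField.eclSubfield_of_isLinIndepExpAlgClosed`) a Zilber field:
`IsZilberField.eclSubfield_isZilberField`. The argument is the printed one with the two uses of
Lemma 8.3 unrolled. Given a rotund, free, `n`-dimensional irreducible `W ⊆ E^{2n}` meeting the
torus and a finite `A ⊆ E`:

1. *base change* (`VarietyAscent.lean`, `VarietyAscentRotund.lean`): `W_K ⊆ K^{2n}` is again
   irreducible, rotund, free, `n`-dimensional, meets the torus, has `E`-points `W`, and is cut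
   out by finitely many polynomials with coefficients in a finite `F₀ ⊆ E`;
2. *hull* ("extending `a` if necessary, we may assume `A ◁ F`"): `0 ◁ K` by the Schanuel property
   and `H = ecl X` is Γ-closed in `K` (Kirby 2010 Thm 1.2, `GammaField.isGammaClosed_span_ecl_univ`),
   hence strong, so `ℚ(F₀ ∪ A)` has a finitely generated strong hull `D` with `F₀ ∪ A ⊆ D ⊆ H`
   (`GammaField.IsStrong.exists_isStrong_of_le`);
3. *axiom 4 of `K`* (in Kirby's linear-independence form, `IsStronglyExpAlgClosed.isLinIndepExpAlgClosed`)
   applied to `W_K` and a finite spanning set of `D` gives `(x̄, e^{x̄}) ∈ W_K` with `x̄` linearly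
   independent over `D`, so `ldim_ℚ(x̄/D) = n`, while `td(x̄, e^{x̄}/D) ≤ n = dim W_K` because
   `W_K` is defined over `ℚ(F₀) ⊆ ℚ(D)` (`Literature.RingTheory.KrullDimension.trdeg_adjoin_le_of_mem`);
   with `D ◁ K` this forces `δ(x̄/D) = 0`;
4. *closedness* ("since `F` is closed in `M`, `B ⊆ F`"): by the addition formula and submodularity,
   `δ(x̄/H) ≤ δ(x̄/ (D + ℚx̄) ∩ H) ≤ 0`, so `x̄ ⊆ H = ecl X` as `H` is Γ-closed; then
   `(x̄, e^{x̄})` is an `E`-point of `W_K`, i.e. a point of `W ∩ Γ`, linearly independent over `A`.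

Everything here is proved; no new named facts.

## References

* M. Bays, J. Kirby, Algebra & Number Theory 12 (2018) 493–549, arXiv:1512.04262: Thm 8.2 and its
  proof (p. 26 of the arXiv version), Lemma 8.3.
* M. Bays, J. Kirby, *Excellence and uncountable categoricity of Zilber's exponential fields*,
  arXiv:1305.0493 (2013): Prop. 4.
* B. Zilber, *Pseudo-exponentiation on algebraically closed fields of characteristic zero*, Ann.
  Pure Appl. Logic 132 (2005) 67–95: §5.
* J. Kirby, *Exponential algebraicity in exponential fields*, Bull. LMS 42 (2010): Thm 1.2.
* J. Kirby, *A note on the axioms for Zilber's pseudo-exponential fields*, Notre Dame J. Formal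
  Logic 54 (2013): §2.3.
-/

noncomputable section

open Set MvPolynomial
open Literature.ModelTheory.ExponentialFields Literature.ModelTheory.ExponentialFields.ExponentialRing

universe u

namespace Literature.NumberTheory.Transcendental

open GammaField

variable {K : Type u} [Field K] [CharZero K] [ExponentialRing K]

/-- **The SGClosed lemma for `ecl`-closed E-subfields** (Bays–Kirby 2018, proof of Thm 8.2 with
Lemma 8.3; Zilber 2005 §5): for a Zilber field `K` and `X ⊆ K`, the E-subfield `ecl X` is strongly
exponentially-algebraically closed in Kirby's linear-independence form — axiom 4 of `K` applied to
the base change `W_K` of a variety `W` over `ecl X`, over a strong hull `D ⊆ ecl X` of the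
parameters, produces a Γ-point of predimension `0` over `D`, which lies in the Γ-closed `ecl X`.
[cite: BaysKirby2018ANT, Thm 8.2 (proof: "since F is closed in M, B ⊆ F. So by Lemma 8.3, F satisfies axiom 4") and Lemma 8.3]
[cite: BaysKirby2013Excellence, Prop. 4 (axiom I.2)] -/
theorem IsZilberField.isLinIndepExpAlgClosed_eclSubfield (hK : IsZilberField K) (X : Set K) :
    IsLinIndepExpAlgClosed (Khovanskii.eclSubfield X) := by
  classical
  haveI := hK.isAlgClosed
  haveI hEac : IsAlgClosed (Khovanskii.eclSubfield X) := Khovanskii.eclSubfield.isAlgClosed X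
  intro n W hirr hne hrot hadd hmul hdim A
  -- Step 1: the base change `W_K` and its data
  set WK : Set (Fin n ⊕ Fin n → K) := VarietyAscent.baseChange K W with hWK
  have hirrK : IsIrreducibleClosed K WK := VarietyAscent.isIrreducibleClosed_baseChange hirr
  have hdimK : zariskiDim K WK = n := (VarietyAscent.zariskiDim_baseChange hirr).trans hdim
  have hneK : (WK ∩ torusLocus K n).Nonempty :=
    VarietyAscent.baseChange_inter_torusLocus_nonempty hirr.1 hne
  have haddK : IsAddFree K n (WK ∩ torusLocus K n) :=
    VarietyAscent.isAddFree_baseChange hirr.1 hne hadd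
  have hmulK : IsMulFree K n (WK ∩ torusLocus K n) :=
    VarietyAscent.isMulFree_baseChange hirr.1 hne hmul
  have hrotK : IsRotund K n (WK ∩ torusLocus K n) :=
    VarietyAscent.isRotund_baseChange hirr hne hrot
  -- `W_K` is cut out by finitely many polynomials with coefficients in a finite `F₀ ⊆ ecl X`
  obtain ⟨G, hG⟩ : (vanishingIdeal (Khovanskii.eclSubfield X) W).FG := IsNoetherian.noetherian _
  set F₀ : Finset K :=
    G.biUnion fun g => g.coeffs.image (algebraMap (Khovanskii.eclSubfield X) K) with hF₀
  have hF₀E : (↑F₀ : Set K) ⊆ ecl X := by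
    intro c hc
    rw [hF₀, Finset.coe_biUnion] at hc
    obtain ⟨g, -, hc⟩ := mem_iUnion₂.1 hc
    rw [Finset.coe_image] at hc
    obtain ⟨a, -, rfl⟩ := hc
    exact a.2
  set k : Subfield K := Subfield.closure (↑F₀ : Set K) with hk
  set GK : Set (MvPolynomial (Fin n ⊕ Fin n) K) :=
    MvPolynomial.map (algebraMap (Khovanskii.eclSubfield X) K) '' (↑G : Set _) with hGK
  have hGKk : GK ⊆ Set.range (MvPolynomial.map (algebraMap k K)) := by
    rintro _ ⟨g, hg, rfl⟩
    rw [mem_range_map_iff_coeffs_subset]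
    intro c hc
    obtain ⟨a, ha, rfl⟩ := coe_coeffs_map (algebraMap (Khovanskii.eclSubfield X) K) g hc
    have haF₀ : algebraMap (Khovanskii.eclSubfield X) K a ∈ (↑F₀ : Set K) := by
      rw [hF₀, Finset.coe_biUnion]
      refine mem_iUnion₂.2 ⟨g, hg, ?_⟩
      rw [Finset.coe_image]
      exact ⟨a, ha, rfl⟩
    exact ⟨⟨_, Subfield.subset_closure haF₀⟩, rfl⟩
  set J : Ideal (MvPolynomial (Fin n ⊕ Fin n) k) :=
    Ideal.span (MvPolynomial.map (algebraMap k K) ⁻¹' GK) with hJ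
  have hWJ : WK = zeroLocus K J := by
    rw [hJ, ← Literature.RingTheory.KrullDimension.zeroLocus_map (F := K), Ideal.map_span,
      Set.image_preimage_eq_of_subset hGKk, hWK, VarietyAscent.baseChange_eq_zeroLocus_map, ← hG,
      Ideal.map_span]
  -- Step 2 ("extending `a` if necessary"): a finitely generated strong hull `D` of `F₀ ∪ A`
  -- inside the Γ-closed `H = ecl X`
  have hbot : IsStrong (⊥ : Submodule ℚ K) :=
    ZilberHomogeneity.isStrong_bot_of_schanuelProperty hK.schanuelProperty
  set H : Submodule ℚ K := Submodule.span ℚ (ecl X) with hH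
  have hHcl : IsGammaClosed H := GammaField.isGammaClosed_span_ecl_univ X
  set AK : Set K := algebraMap (Khovanskii.eclSubfield X) K '' (↑A : Set _) with hAK
  set Λ' : Submodule ℚ K := Submodule.span ℚ (↑F₀ ∪ AK) with hΛ'
  have hΛ'H : Λ' ≤ H := by
    rw [hΛ', hH]
    refine Submodule.span_mono (union_subset hF₀E ?_)
    rintro _ ⟨a, -, rfl⟩
    exact a.2
  have hfgΛ' : IsFG (⊥ : Submodule ℚ K) Λ' :=
    isFG_span_of_finite ⊥ (F₀.finite_toSet.union (A.finite_toSet.image _))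
  obtain ⟨D, hΛ'D, hDH, hfgD, hD⟩ := hbot.exists_isStrong_of_le hHcl.isStrong bot_le hΛ'H hfgΛ'
  obtain ⟨T, hTD, hDT⟩ := isFG_iff_exists_finset.1 hfgD
  have hT : Submodule.span ℚ (↑T : Set K) = D :=
    le_antisymm (Submodule.span_le.2 hTD) (by rwa [bot_sup_eq] at hDT)
  -- Step 3: axiom 4 of `K` (linear-independence form) for `W_K` over `T`
  have hLIK : IsLinIndepExpAlgClosed K := hK.isStronglyExpAlgClosed.isLinIndepExpAlgClosed
  obtain ⟨z, ⟨hzW, hzexp⟩, hzlin⟩ := hLIK n WK hirrK hneK hrotK haddK hmulK hdimK T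
  set x : Fin n → K := z ∘ Sum.inl with hx
  have hz : z = gammaPt x := (mem_expGraph_iff_eq_gammaPt z).1 hzexp
  have hlin : LinIndepOver D x := ZilberSaturationMain.linIndepOver_of_forall_intCast T hT hzlin
  -- `δ(x̄/D) = 0`: `ldim(x̄/D) = n`, `td(x̄, exp x̄/D) ≤ n` (`W_K` is defined over `ℚ(F₀) ⊆ ℚ(D)`),
  -- and `D ◁ K`
  set V : Submodule ℚ K := Submodule.span ℚ (range x) with hV
  have hfg : IsFG D V := isFG_span_of_finite D (finite_range x)
  have hδ0 : 0 ≤ predim D V := (isStrong_iff.1 hD) _ hfg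
  have hldim : ldim D V = n := ldim_span_eq_of_linIndepOver hlin
  have hk_acl : (k : Set K) ⊆ (algMatroid K).closure (gens D) := by
    refine (subfieldClosure_subset_acl _).trans (acl_subset_acl_of_subset ?_)
    intro a ha
    exact subset_acl _ (subset_gens D (hΛ'D (Submodule.subset_span (Or.inl ha))))
  have hrange : range z = range x ∪ exp '' range x := by
    rw [hz, ZilberSaturationMain.range_gammaPt]
  have htrdeg : Algebra.trdeg k (Algebra.adjoin k (range z)) ≤ n :=
    Literature.RingTheory.KrullDimension.trdeg_adjoin_le_of_mem J hWJ hirrK.2 hdimK hzW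
  have htd : td D V ≤ n :=
    calc td D V ≤ (algMatroid K).relRank (gens D) (range x ∪ exp '' range x) :=
          td_span_le_relRank D (range x)
      _ = (algMatroid K).relRank ((algMatroid K).closure (gens D)) (range z) := by
          rw [hrange, Matroid.relRank_closure_left]
      _ ≤ (algMatroid K).relRank (k : Set K) (range z) := (algMatroid K).relRank_anti_left _ hk_acl
      _ ≤ n := ZilberGSGC.relRank_le_of_trdeg_le k (range z) htrdeg
  have hδ : predim D V = 0 := by
    rw [predim_def, hldim] at hδ0 ⊢
    have h1 : (td D V).toNat ≤ n := by
      have := ENat.toNat_le_toNat htd (ENat.coe_ne_top n)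
      simpa using this
    omega
  -- Step 4 ("since `F` is closed in `M`, `B ⊆ F`"): `x̄ ⊆ H` by Γ-closedness of `H = ecl X`
  set V' : Submodule ℚ K := D ⊔ V with hV'
  have hfgV' : IsFG D V' := isFG_sup_left.2 hfg
  have h1 : D ≤ V' ⊓ H := le_inf le_sup_left hDH
  have h2 : V' ⊓ H ≤ V' := inf_le_left
  have hadd' := predim_add h1 h2 hfgV'
  have hDV' : predim D V' = 0 := by rw [hV', predim_sup_left]; exact hδ
  have hpos : 0 ≤ predim D (V' ⊓ H) := hD h1 (hfgV'.mono h2)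
  have hfgXH : IsFG (V' ⊓ H) V' := hfgV'.of_le_left h1
  have hsub : predim H (V' ⊔ H) ≤ predim (V' ⊓ H) V' := predim_sup_le V' H hfgXH
  have hle0 : predim H (V' ⊔ H) ≤ 0 := by linarith
  have hfgH : IsFG H (V' ⊔ H) := isFG_sup_right.2 ((isFG_iff_isFG_inf V' H).2 hfgXH)
  have hVH : V' ⊔ H = H := hHcl le_sup_right hfgH hle0
  have hxH : ∀ i, x i ∈ ecl X := fun i => by
    have hi : x i ∈ V' ⊔ H :=
      Submodule.mem_sup_left (Submodule.mem_sup_right (Submodule.subset_span ⟨i, rfl⟩))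
    rw [hVH, hH, GammaField.mem_span_ecl_iff] at hi
    exact hi
  -- the `E`-point `(x̄, e^{x̄})` of `W_K` is the required point of `W ∩ Γ`
  have hzE : ∀ j, z j ∈ ecl X := by
    rintro (i | i)
    · exact hxH i
    · rw [(mem_expGraph_iff.1 hzexp) i]
      exact Khovanskii.exp_mem_ecl (hxH i)
  set zE : Fin n ⊕ Fin n → Khovanskii.eclSubfield X := fun j => ⟨z j, hzE j⟩ with hzEdef
  have hzEK : algebraMap (Khovanskii.eclSubfield X) K ∘ zE = z := funext fun _ => rfl
  refine ⟨zE, ⟨?_, ?_⟩, fun m hm => hzlin m ?_⟩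
  · exact (VarietyAscent.comp_mem_baseChange_iff hirr.1 zE).1 (by rw [hzEK]; exact hzW)
  · exact (VarietyAscent.comp_mem_expGraph_iff (F := K) (fun _ => rfl) zE).1
      (by rw [hzEK]; exact hzexp)
  · -- a `ℚ`-linear relation over `A` maps to one over `D ⊇ A`
    have hmap : (∑ i, (m i : K) * z (Sum.inl i)) = algebraMap (Khovanskii.eclSubfield X) K
        (∑ i, (m i : Khovanskii.eclSubfield X) * zE (Sum.inl i)) := by
      simp only [map_sum, map_mul, map_intCast]
      rfl
    rw [hmap, hT]
    refine Submodule.span_induction (p := fun c _ => algebraMap (Khovanskii.eclSubfield X) K c ∈ D)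
      ?_ ?_ ?_ ?_ hm
    · intro a ha
      exact hΛ'D (Submodule.subset_span (Or.inr ⟨a, ha, rfl⟩))
    · rw [map_zero]; exact D.zero_mem
    · intro a b _ _ ha hb
      rw [map_add]; exact D.add_mem ha hb
    · intro q a _ ha
      rw [map_rat_smul]; exact D.smul_mem q ha

/-- **`ecl`-closed E-subfields of Zilber fields are Zilber fields** (Zilber 2005 §5; Bays–Kirby
2013, Prop. 4 = Kirby's axiom I.2 for `ECF_{SK,CCP}`; Bays–Kirby 2018, proof of Thm 8.2): for a
Zilber field `K` and any `X ⊆ K`, the E-subfield `ecl X` with the restricted exponential is a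
Zilber field — algebraically closed, standard kernel, surjective `exp`, Schanuel property and
countable closures by `EclClosedSubfield.lean`, strong exponential-algebraic closedness by
`IsZilberField.isLinIndepExpAlgClosed_eclSubfield` (converted to the genericity form by Kirby 2013
§2.3). [cite: BaysKirby2013Excellence, Prop. 4 (axiom I.2)] [cite: BaysKirby2018ANT, Thm 8.2 (proof)] -/
theorem IsZilberField.eclSubfield_isZilberField (hK : IsZilberField K) (X : Set K) :
    IsZilberField (Khovanskii.eclSubfield X) :=
  hK.eclSubfield_of_isLinIndepExpAlgClosed X (hK.isLinIndepExpAlgClosed_eclSubfield X)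

end Literature.NumberTheory.Transcendental

end
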